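import Summits.RiemannHypothesis.RiemannHypothesis.Theorems.PfPersistenceF1BLExt

/-!
# `BLExtRigid` is monotone in the depth (pub-rhpf fake-1; mechanism/rigidity campaign; no RH claims)

RULING A137 ADDENDUM-ANSWER (adj-3) asked that the monotonicity of the graded family `BLExtRigid U` be a
sentence of record: honesty below a larger depth is a *stronger* hypothesis on a g-prime system, so
rigidity at a larger depth is the *weaker* statement, and rigidity at depth `1` (where honesty is
vacuous) implies rigidity at every depth.  Consequently `(∀ U, BLExtRigid U) ↔ BLExtRigid 1`, and nobody
should read '`BLExtRigid U` for one large `U`' as Beurling rigidity.  Dually, a depth-`U'` fake (a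
non-prime-identical honest system with a spectral measure) is a depth-`U` fake for every `0 < U ≤ U'`.
Everything here is an elementary consequence of `HonestBelow.anti` / `honestBelow_one`; nothing about
`ζ` is asserted.
-/

set_option linter.dupNamespace false

open MeasureTheory Set

namespace Summit.RiemannHypothesis.RiemannHypothesis.Theorems.PfPersistence.Fake1.BLExt

open Summit.RiemannHypothesis.RiemannHypothesis.Theorems.PfPersistenceBarrier
open Summit.RiemannHypothesis.RiemannHypothesis.Theorems.PfPersistence.Fake1

/-- Monotonicity in the depth: for `0 < U ≤ U'`, rigidity at depth `U` implies rigidity at depth `U'`.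
[folklore] -/
theorem BLExtRigid.mono {U U' : ℝ} (hU : 0 < U) (hUU' : U ≤ U') (h : BLExtRigid U) :
    BLExtRigid U' := by
  intro μ g m hg hinj hhon hμ
  exact h μ g m hg hinj (hhon.anti hU hUU') hμ

/-- Rigidity at depth `1` is rigidity at every depth (honesty at depth `1` holds for every datum, so the
depth-`1` statement quantifies over all systems). [folklore] -/
theorem BLExtRigid.of_one (h : BLExtRigid 1) (U : ℝ) : BLExtRigid U := by
  intro μ g m hg hinj _ hμ
  exact h μ g m hg hinj (honestBelow_one _) hμ

/-- The graded family collapses at depth `1`: `(∀ U, BLExtRigid U) ↔ BLExtRigid 1`. [folklore] -/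
theorem forall_blExtRigid_iff_one : (∀ U : ℝ, BLExtRigid U) ↔ BLExtRigid 1 :=
  ⟨fun h => h 1, fun h U => h.of_one U⟩

/-- With spectral measures granted, rigidity at any single depth `U ≤ 1` (with `0 < U`) is already the
whole of `BeurlingRigidity`. [folklore] -/
theorem beurlingRigidity_of_blExtRigid_le_one (hS : SpectralMeasureExists) {U : ℝ} (hU : 0 < U)
    (hU1 : U ≤ 1) (h : BLExtRigid U) : BeurlingRigidity :=
  beurlingRigidity_of_blExtRigid hS (h.mono hU hU1)

/-- Fakes are antitone in the depth: a non-prime-identical g-prime system that is honest below `U'` and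
has a spectral measure witnesses the failure of rigidity at every depth `0 < U ≤ U'`. [folklore] -/
theorem not_blExtRigid_anti {U U' : ℝ} (hU : 0 < U) (hUU' : U ≤ U') (h : ¬ BLExtRigid U') :
    ¬ BLExtRigid U :=
  fun hU_rigid => h (hU_rigid.mono hU hUU')

/-- The same in witness form: the data of a depth-`U'` fake are the data of a depth-`U` fake.
[folklore] -/
theorem fake_anti {U U' : ℝ} (hU : 0 < U) (hUU' : U ≤ U')
    (hex : ∃ (μ : Measure ℝ) (g : ℕ → ℝ) (m : ℕ → ℕ), (∀ i, 1 < g i) ∧ Function.Injective g ∧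
      HonestBelow (beurlingDatum g m) U' ∧ IsSpectralMeasure (beurlingDatum g m) μ ∧ ¬ PrimeIdentical g m) :
    ∃ (μ : Measure ℝ) (g : ℕ → ℝ) (m : ℕ → ℕ), (∀ i, 1 < g i) ∧ Function.Injective g ∧
      HonestBelow (beurlingDatum g m) U ∧ IsSpectralMeasure (beurlingDatum g m) μ ∧ ¬ PrimeIdentical g m := by
  obtain ⟨μ, g, m, hg, hinj, hhon, hμ, hfake⟩ := hex
  exact ⟨μ, g, m, hg, hinj, hhon.anti hU hUU', hμ, hfake⟩

/-- `¬ BLExtRigid U` is exactly the existence of a depth-`U` fake. [folklore] -/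
theorem not_blExtRigid_iff (U : ℝ) : ¬ BLExtRigid U ↔
    ∃ (μ : Measure ℝ) (g : ℕ → ℝ) (m : ℕ → ℕ), (∀ i, 1 < g i) ∧ Function.Injective g ∧
      HonestBelow (beurlingDatum g m) U ∧ IsSpectralMeasure (beurlingDatum g m) μ ∧ ¬ PrimeIdentical g m := by
  constructor
  · intro h
    by_contra hne
    apply h
    intro μ g m hg hinj hhon hμ
    by_contra hp
    exact hne ⟨μ, g, m, hg, hinj, hhon, hμ, hp⟩
  · rintro ⟨μ, g, m, hg, hinj, hhon, hμ, hp⟩ h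
    exact hp (h μ g m hg hinj hhon hμ)

end Summit.RiemannHypothesis.RiemannHypothesis.Theorems.PfPersistence.Fake1.BLExt
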